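import Summits.BirchSwinnertonDyer.BirchSwinnertonDyer.Theorems.AdditiveKolyvaginRoadSwitchedLevelDescentParity
import Summits.BirchSwinnertonDyer.BirchSwinnertonDyer.Theorems.AdditiveKolyvaginRoadLagrangianSwitchAtP
import Summits.BirchSwinnertonDyer.BirchSwinnertonDyer.Theorems.AdditiveKolyvaginRoadLocalTorsionTrivialOfLocIrr
import Summits.BirchSwinnertonDyer.BirchSwinnertonDyer.Theorems.AdditiveKolyvaginRoadLevelKolyvaginSystemsAdditiveSplitCompletion
import Summits.BirchSwinnertonDyer.BirchSwinnertonDyer.Theorems.AdditiveKolyvaginRoadThetaCycleSeedFirstLemmas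
import Summits.BirchSwinnertonDyer.Rank1Residual.GaloisImage.PropagatedConditionCount
import Literature.NumberTheory.GaloisRepresentations.PadicAlgebraDegreeOnePlace
import Literature.NumberTheory.Automorphic.AdicCompletionDegreeOnePlaceProofs
import HarnessLib

/-!
# Route `AdditiveKolyvaginRoad`, crux KS′ `LevelKolyvaginSystemsAdditive` (stmt-BirchSwinnertonDyer-21396) ∕ KPA′ (stmt-BirchSwinnertonDyer-21400):
# THE SPLIT PLANE COUNT — `E(ℚ_p)[p] = 0` and the PLANE `#H¹(K_𝔭, E[p]) = p²` moved to the completions `K_𝔭` of the Heegner field at the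
# two places above the split additive prime `p`, and discharged on the `LocIrr` locus
# (cell `pub/bsd-wall`, width seat `bsd-wall-akr-p2x-w4` g5; `--supports stmt-BirchSwinnertonDyer-21396`, helper; E-side glue)

WHY. Every at-`p` statement of this crux over the imaginary quadratic field `K` carries the PLANE binder
`#H¹(K_𝔭, E[p]) = p²` at the places `𝔭 ∣ p` — `hH` of the one-place Lagrangian switches (`LagrangianSwitchAtP.natCard_selmerGroup_switch*`),
`hH₁ ∕ hH₂` of the double switch and of the SWITCHED-SPACES assembly `exists_level_switched_eq_bot_card_odd_iff` (akr-p2x-w3 g10; the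
E-side of stub T2 of the crux card `Cruxes/LevelKolyvaginSystemsAdditive/Ideas/irred-vertex-anchor.md`, which writes «ρ̄|G_{ℚ_p}
IRREDUCIBLE, hence (a) `#H¹(ℚ_p, ρ̄) = p²` (a PLANE: `H⁰ = H² = 0`)»), `h𝔭` of (T4) `bdpSwitchAtBottom`. The tree proves the plane from
`E(K_v)[p] = 0` and `#(𝓞_v ⧸ p) = p` (`LagrangianSwitchAtP.natCard_localH1_eq_sq`, Tate's local Euler–Poincaré characteristic, PROVED), and
proves `E(ℚ_p)[p] = 0` on the `LocIrr` locus (`LocalTorsion.localTorsionTrivial_of_locIrr`, FL-1 of card `universal-zeta-transport-anchor`) —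
but over `ℚ_p`, whereas the consumers live at `K_𝔭`. At a ♯ frame `p ∣ N` SPLITS in `K` (Heegner hypothesis), so `K_𝔭 ≅ ℚ_p`
(`[K_𝔭 : ℚ_p] = e f = 1`; tree: `LocalField.bijective_algebraMap_adicCompletionPadicAlgebra`, akr-p2x-w2 g3's `SplitCompletion` bricks,
`Automorphic.exists_ringEquiv_adicCompletion_of_ramificationIdx_eq_one_of_inertiaDeg_eq_one`). This file carries both local inputs across
that isomorphism and discharges the plane binders BY NAME on the `LocIrr` locus (the B-cells of `irred-vertex-anchor`, the (Lgl) locus of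
Fouquet–Wan).

WHAT (namespace `…Theorems.AdditiveKoly.SplitPlane`; `W/ℚ`, `K` a number field, `w` a finite place of `K` with `p ∈ w`).
* §1 `natCard_residue_eq_of_degree_one` — `e(w|p) = f(w|p) = 1 ⟹ #(𝓞_w ⧸ p) = p` (𝒪-level isomorphism `ℤ_{(p)} ≃ 𝓞_w` + the count over `ℚ`);
  `natCard_residue_eq_of_split` — the same for `[K : ℚ] = 2` with two primes above `p`.
* §2 `forall_nsmul_eq_zero_of_ringHom_padic` — for ANY `K`-field `F` with a ring map `F → ℚ_p`: `E(ℚ_p)[n] = 0 ⟹ E_K(F)[n] = 0`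
  (injective `Point.map`; ring maps out of `ℚ` are unique); `forall_nsmul_eq_zero_adicCompletion_of_degree_one ∕ _of_split` — at `F = K_w`.
* §3 `natCard_localH1_eq_sq_of_degree_one ∕ _of_split` — `E(ℚ_p)[p] = 0 ⟹ #H¹(K_w, E_K[p]) = p²`.
* §4 `forall_nsmul_eq_zero_padic_of_locIrr`; **`natCard_localH1_eq_sq_of_locIrr`** (`[K : ℚ] = 2`, `p` split, `LocIrr W p` ⟹ the plane at EVERY
  `w ∣ p`); **`natCard_localH1_eq_sq_of_locIrr_of_heegner`** (♯-frame form: `K` imaginary quadratic, Heegner hypothesis for `N_E`, `p ∣ N_E`);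
  `natCard_ker_nsmul_adicCompletion_eq_one_of_locIrr` (the same in the `#E_K(K_w)[p] = 1` currency of the Euler-characteristic products).
* §5 `exists_places_of_split` ∕ `eq_or_eq_of_ne` — the split data `𝔭 ≠ 𝔭'`, `honly` of the assembly from `[K : ℚ] = 2` (+ two primes above `p`).
* §6 **`exists_level_switched_eq_bot_card_odd_iff_of_locIrr`** — akr-p2x-w3 g10's T2 assembly with its binders `honly`, `hH₁`, `hH₂` DISCHARGED:
  on the `LocIrr` locus they follow from the frame (`K` imaginary quadratic, `𝔭 ≠ 𝔭'` above `p`).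
* §7 **`bdpSwitchAtBottom_of_locIrr`** — (T4) of card `theta-cycle-seed` (akr-p2x-w4 g4's `ThetaCycleSeed.bdpSwitchAtBottom`) at a ♯ frame with its
  DUAL.2 binder (PROVED: `poitouTate_selmerStructure_duality_holds`) and both plane binders discharged — unconditional on the `LocIrr` locus.

HONEST FRAMING: theorems only; 0 definitions, 0 named facts, 0 `sorry`; E-side glue; closes nothing. BSD is not proved by any of this;
KS′/KPA′ stay OPEN at `p² ∣ N`.

References: [cite: CasselsFrohlichANT1967, Ch. II §10 Theorem (10.2)] [cite: MilneADT2006, Ch. I, Thm. 2.8, Lemma 3.3]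
[cite: Mazur1977, Ch. III §5, p. 157] [cite: FouquetWan2021, Thm. 5.1] [cite: SilvermanAEC2009, VII.3 Prop. 3.1] [cite: WZhang2014, Prop. 5.4, §9].
-/

-- single-conjunct summit: `Summit.BirchSwinnertonDyer.BirchSwinnertonDyer.…` repeats the name by design
set_option linter.dupNamespace false
set_option autoImplicit false

noncomputable section

open scoped Classical NumberField

namespace Summit.BirchSwinnertonDyer.BirchSwinnertonDyer.Theorems.AdditiveKoly.SplitPlane

open WeierstrassCurve Field Function NumberField IsDedekindDomain
open Literature.NumberTheory.EllipticCurves Literature.NumberTheory.EllipticCurves.Rank1Residual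
  Literature.NumberTheory.GaloisRepresentations
open Literature.NumberTheory.GaloisRepresentations.DiscreteGaloisModule
open Literature.NumberTheory.GaloisCohomology
open Summit.BirchSwinnertonDyer.Rank1Residual.X11b Summit.BirchSwinnertonDyer.Rank1Residual.X11b.Relaxation
open Summit.BirchSwinnertonDyer.Rank1Residual.Additive
open Summit.BirchSwinnertonDyer.BirchSwinnertonDyer.Theorems.SchneiderFreeAdditiveX3.PoitouTateReduction
  (poitouTate_selmerStructure_duality_holds)
open scoped ContRepresentation

/-! ## §1 The residue count `#(𝓞_w ⧸ p) = p` at a place of degree one -/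

section Residue

variable {K : Type} [Field K] [NumberField K] (p : ℕ) [Fact p.Prime]

/-- **`#(𝓞_w ⧸ p 𝓞_w) = p` at a place `w ∋ p` of degree one** (`e(w|p) = f(w|p) = 1` over `𝓞 ℚ`): the ring of `w`-adic integers is
isomorphic to the `(p)`-adic integers of `ℚ` (`Automorphic.exists_ringEquiv_adicCompletion_of_ramificationIdx_eq_one_of_inertiaDeg_eq_one`,
the degree-one case of `[K_w : ℚ_p] = e f`), where the count is `#(ℤ_p ⧸ p) = p` (`GaloisImage.natCard_quot_adicCompletionIntegers_of_prime_mem`).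
[cite: CasselsFrohlichANT1967, Ch. II §10 Theorem (10.2)] -/
theorem natCard_residue_eq_of_degree_one (w : HeightOneSpectrum (𝓞 K)) (hw : ((p : ℕ) : 𝓞 K) ∈ w.asIdeal)
    (he : w.asIdeal.ramificationIdx (𝓞 ℚ) = 1) (hf : w.asIdeal.inertiaDeg (𝓞 ℚ) = 1) :
    Nat.card (w.adicCompletionIntegers K ⧸ Ideal.span {((p : ℕ) : w.adicCompletionIntegers K)}) = p := by
  set u : HeightOneSpectrum (𝓞 ℚ) := w.under (𝓞 ℚ) with hu
  haveI : w.asIdeal.LiesOver u.asIdeal := by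
    rw [hu, HeightOneSpectrum.under_asIdeal]; infer_instance
  obtain ⟨ψ, -, -, -⟩ :=
    Literature.NumberTheory.Automorphic.exists_ringEquiv_adicCompletion_of_ramificationIdx_eq_one_of_inertiaDeg_eq_one
      ℚ K u w he hf
  have hup : ((p : ℕ) : 𝓞 ℚ) ∈ u.asIdeal := SplitCompletion.natCast_mem_under K p w hw
  refine (Nat.card_congr (Ideal.quotientEquiv _ _ ψ.symm ?_).toEquiv).trans
    (Summit.BirchSwinnertonDyer.Rank1Residual.GaloisImage.natCard_quot_adicCompletionIntegers_of_prime_mem p hup)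
  rw [Ideal.map_span, Set.image_singleton, map_natCast]

/-- **`#(𝓞_w ⧸ p) = p` at a prime above a split `p` of a quadratic field** (`[K : ℚ] = 2`, two primes of `𝓞 K` above `p`: every `w ∋ p`
has `e = f = 1`, akr-p2x-w2 g3's `SplitCompletion.ramificationIdx_eq_one_of_card_primesOver` ∕ `inertiaDeg_eq_one_of_card_primesOver`).
[cite: NeukirchANT1999, Ch. II §8 (8.5)] -/
theorem natCard_residue_eq_of_split (hK2 : Module.finrank ℚ K = 2)
    (hsplit : ((Ideal.span {(p : ℤ)}).primesOver (𝓞 K)).ncard = 2)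
    (w : HeightOneSpectrum (𝓞 K)) (hw : ((p : ℕ) : 𝓞 K) ∈ w.asIdeal) :
    Nat.card (w.adicCompletionIntegers K ⧸ Ideal.span {((p : ℕ) : w.adicCompletionIntegers K)}) = p :=
  natCard_residue_eq_of_degree_one p w hw (SplitCompletion.ramificationIdx_eq_one_of_card_primesOver K p hK2 hsplit w hw)
    (SplitCompletion.inertiaDeg_eq_one_of_card_primesOver K p hK2 hsplit w hw)

end Residue

/-! ## §2 Torsion transport: `E(ℚ_p)[n] = 0 ⟹ E_K(F)[n] = 0` along any ring map `F → ℚ_p` -/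

section Torsion

variable (W : WeierstrassCurve ℚ) {K : Type} [Field K] (p : ℕ) [Fact p.Prime]

/-- **No `n`-torsion over a `K`-field mapping to `ℚ_p` from none over `ℚ_p`.** `W/ℚ`, `K` a field of characteristic `0`, `F` a `K`-field with
a ring homomorphism `φ : F → ℚ_p`: if `E(ℚ_p)` has no non-zero point killed by `n` then neither has `E_K(F) = (W ⊗ K ⊗ F)(F)`. Along `φ`
(a `K`-algebra map for the induced `K`-structure on `ℚ_p`) Mathlib's `Affine.Point.map` is an INJECTIVE group homomorphism
`E_K(F) → (W ⊗ K ⊗ ℚ_p)(ℚ_p)`, and `W ⊗ K ⊗ ℚ_p = W ⊗ ℚ_p` because ring maps `ℚ → ℚ_p` are unique. [cite: SilvermanAEC2009, VII.3 Prop. 3.1] -/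
theorem forall_nsmul_eq_zero_of_ringHom_padic [CharZero K] {F : Type} [Field F] [Algebra K F] (φ : F →+* ℚ_[p]) (n : ℕ)
    (h : ∀ Q : (W.baseChange ℚ_[p]).toAffine.Point, n • Q = 0 → Q = 0) :
    ∀ P : ((W.baseChange K).baseChange F).toAffine.Point, n • P = 0 → P = 0 := by
  letI : Algebra K ℚ_[p] := (φ.comp (algebraMap K F)).toAlgebra
  let f : F →ₐ[K] ℚ_[p] := ⟨φ, fun _ ↦ rfl⟩
  have hcurve : (W.baseChange K).baseChange ℚ_[p] = W.baseChange ℚ_[p] := by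
    simp only [WeierstrassCurve.baseChange, WeierstrassCurve.map_map]
    exact congrArg W.map (Subsingleton.elim _ _)
  have h' : ∀ Q : ((W.baseChange K).baseChange ℚ_[p]).toAffine.Point, n • Q = 0 → Q = 0 := by
    rw [hcurve]; exact h
  intro P hP
  have h1 : n • Affine.Point.map (W' := W.baseChange K) f P = 0 := by
    rw [← map_nsmul, hP, map_zero]
  exact Affine.Point.map_injective (W' := W.baseChange K) (f := f) ((h' _ h1).trans (map_zero _).symm)

variable [NumberField K]

/-- **`E(ℚ_p)[n] = 0 ⟹ E_K(K_w)[n] = 0` at a place `w ∋ p` of degree one** (`K_w ≅ ℚ_p`: the canonical `ℚ_p → K_w`,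
`LocalField.adicCompletionPadicAlgebra`, is bijective at `e = f = 1`, `LocalField.bijective_algebraMap_adicCompletionPadicAlgebra`).
[cite: CasselsFrohlichANT1967, Ch. II §10 Theorem (10.2)] [cite: SilvermanAEC2009, VII.3 Prop. 3.1] -/
theorem forall_nsmul_eq_zero_adicCompletion_of_degree_one (w : HeightOneSpectrum (𝓞 K)) (hw : ((p : ℕ) : 𝓞 K) ∈ w.asIdeal)
    (he : w.asIdeal.ramificationIdx (𝓞 ℚ) = 1) (hf : w.asIdeal.inertiaDeg (𝓞 ℚ) = 1) (n : ℕ)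
    (h : ∀ Q : (W.baseChange ℚ_[p]).toAffine.Point, n • Q = 0 → Q = 0) :
    ∀ P : ((W.baseChange K).baseChange (w.adicCompletion K)).toAffine.Point, n • P = 0 → P = 0 := by
  letI := LocalField.adicCompletionPadicAlgebra w p hw
  have hb := LocalField.bijective_algebraMap_adicCompletionPadicAlgebra p w hw he hf
  exact forall_nsmul_eq_zero_of_ringHom_padic W p
    (RingEquiv.ofBijective (algebraMap ℚ_[p] (w.adicCompletion K)) hb).symm.toRingHom n h

/-- **`E(ℚ_p)[n] = 0 ⟹ E_K(K_w)[n] = 0` at every `w ∋ p` when `p` splits in the quadratic field `K`.** [cite: SilvermanAEC2009, VII.3 Prop. 3.1] -/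
theorem forall_nsmul_eq_zero_adicCompletion_of_split (hK2 : Module.finrank ℚ K = 2)
    (hsplit : ((Ideal.span {(p : ℤ)}).primesOver (𝓞 K)).ncard = 2)
    (w : HeightOneSpectrum (𝓞 K)) (hw : ((p : ℕ) : 𝓞 K) ∈ w.asIdeal) (n : ℕ)
    (h : ∀ Q : (W.baseChange ℚ_[p]).toAffine.Point, n • Q = 0 → Q = 0) :
    ∀ P : ((W.baseChange K).baseChange (w.adicCompletion K)).toAffine.Point, n • P = 0 → P = 0 :=
  forall_nsmul_eq_zero_adicCompletion_of_degree_one W p w hw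
    (SplitCompletion.ramificationIdx_eq_one_of_card_primesOver K p hK2 hsplit w hw)
    (SplitCompletion.inertiaDeg_eq_one_of_card_primesOver K p hK2 hsplit w hw) n h

end Torsion

/-! ## §3 The PLANE `#H¹(K_w, E_K[p]) = p²` at a place of degree one from `E(ℚ_p)[p] = 0` -/

section Plane

variable (W : WeierstrassCurve ℚ) [W.IsElliptic] {K : Type} [Field K] [NumberField K] (p : ℕ) [Fact p.Prime]

/-- **The plane at a place of degree one.** `w ∋ p` with `e(w|p) = f(w|p) = 1` and `E(ℚ_p)[p] = 0` ⟹ `#H¹(K_w, E_K[p]) = p²`: Tate's local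
Euler–Poincaré characteristic `#H¹ = (#E_K(K_w)[p] · #(𝓞_w ⧸ p))²` (`LagrangianSwitchAtP.natCard_localH1_eq_sq`) with §2 (`E_K(K_w)[p] = 0`)
and §1 (`#(𝓞_w ⧸ p) = p`). [cite: MilneADT2006, Ch. I, Thm. 2.8 and Lemma 3.3] -/
theorem natCard_localH1_eq_sq_of_degree_one (w : HeightOneSpectrum (𝓞 K)) (hw : ((p : ℕ) : 𝓞 K) ∈ w.asIdeal)
    (he : w.asIdeal.ramificationIdx (𝓞 ℚ) = 1) (hf : w.asIdeal.inertiaDeg (𝓞 ℚ) = 1)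
    (h : ∀ Q : (W.baseChange ℚ_[p]).toAffine.Point, (p ^ 1) • Q = 0 → Q = 0) :
    Nat.card (galoisCohomology (((W.baseChange K).torsionGaloisModule ((p ^ 1 : ℕ) : ℤ)).toLocal (Sum.inr w : Place K)) 1) =
      p ^ 2 := by
  refine LagrangianSwitchAtP.natCard_localH1_eq_sq (W.baseChange K) p w
    (forall_nsmul_eq_zero_adicCompletion_of_degree_one W p w hw he hf (p ^ 1) h) ?_
  rw [pow_one]
  exact natCard_residue_eq_of_degree_one p w hw he hf

/-- **The plane at every `w ∋ p` for `p` split in the quadratic field `K`**, from `E(ℚ_p)[p] = 0`. [cite: MilneADT2006, Ch. I, Thm. 2.8 and Lemma 3.3] -/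
theorem natCard_localH1_eq_sq_of_split (hK2 : Module.finrank ℚ K = 2)
    (hsplit : ((Ideal.span {(p : ℤ)}).primesOver (𝓞 K)).ncard = 2)
    (w : HeightOneSpectrum (𝓞 K)) (hw : ((p : ℕ) : 𝓞 K) ∈ w.asIdeal)
    (h : ∀ Q : (W.baseChange ℚ_[p]).toAffine.Point, (p ^ 1) • Q = 0 → Q = 0) :
    Nat.card (galoisCohomology (((W.baseChange K).torsionGaloisModule ((p ^ 1 : ℕ) : ℤ)).toLocal (Sum.inr w : Place K)) 1) =
      p ^ 2 :=
  natCard_localH1_eq_sq_of_degree_one W p w hw (SplitCompletion.ramificationIdx_eq_one_of_card_primesOver K p hK2 hsplit w hw)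
    (SplitCompletion.inertiaDeg_eq_one_of_card_primesOver K p hK2 hsplit w hw) h

end Plane

/-! ## §4 On the `LocIrr` locus the planes are automatic -/

section LocIrr

variable (W : WeierstrassCurve ℚ) [W.IsElliptic] (p : ℕ) [Fact p.Prime]

/-- **`LocIrr ⟹ E(ℚ_p)[p] = 0`** in the `∀ Q, p • Q = 0 → Q = 0` currency of the plane count (FL-1: `E[p]` an irreducible `G_{ℚ_p}`-module has
no `ℚ_p`-rational line; `LocalTorsion.eq_zero_of_nsmul_eq_zero_of_hasIrreducibleModPGaloisRep`). [cite: Mazur1977, Ch. III §5, p. 157]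
[cite: FouquetWan2021, Thm. 5.1 (second hypothesis)] -/
theorem forall_nsmul_eq_zero_padic_of_locIrr (hL : LocIrr W p) :
    ∀ Q : (W.baseChange ℚ_[p]).toAffine.Point, (p ^ 1) • Q = 0 → Q = 0 := by
  haveI : (W.baseChange ℚ_[p]).IsElliptic := by
    rw [WeierstrassCurve.baseChange]; infer_instance
  haveI : NeZero ((p : ℕ) : ℚ_[p]) := ⟨Nat.cast_ne_zero.mpr (Fact.out : p.Prime).ne_zero⟩
  intro Q hQ
  rw [pow_one] at hQ
  exact LocalTorsion.eq_zero_of_nsmul_eq_zero_of_hasIrreducibleModPGaloisRep (W.baseChange ℚ_[p]) p hL Q hQ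

variable {K : Type} [Field K] [NumberField K]

/-- **THE SPLIT PLANE COUNT on the `LocIrr` locus.** `W/ℚ`, `[K : ℚ] = 2` with two primes above `p`, `E[p]` irreducible as a `G_{ℚ_p}`-module:
at EVERY place `w ∋ p` of `K`, `#H¹(K_w, E_K[p]) = p²` — the binder `hH` ∕ `hH₁` ∕ `hH₂` of the Lagrangian switches at `p` and of the
switched-spaces assembly, the «(a) PLANE» of card `irred-vertex-anchor`, over `K`. [cite: MilneADT2006, Ch. I, Thm. 2.8 and Lemma 3.3]
[cite: Mazur1977, Ch. III §5, p. 157] [cite: CasselsFrohlichANT1967, Ch. II §10 Theorem (10.2)] -/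
theorem natCard_localH1_eq_sq_of_locIrr (hK2 : Module.finrank ℚ K = 2)
    (hsplit : ((Ideal.span {(p : ℤ)}).primesOver (𝓞 K)).ncard = 2) (hL : LocIrr W p)
    (w : HeightOneSpectrum (𝓞 K)) (hw : ((p : ℕ) : 𝓞 K) ∈ w.asIdeal) :
    Nat.card (galoisCohomology (((W.baseChange K).torsionGaloisModule ((p ^ 1 : ℕ) : ℤ)).toLocal (Sum.inr w : Place K)) 1) =
      p ^ 2 :=
  natCard_localH1_eq_sq_of_split W p hK2 hsplit w hw (forall_nsmul_eq_zero_padic_of_locIrr W p hL)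

/-- **THE SPLIT PLANE COUNT at a ♯ frame.** `W/ℚ` globally minimal of conductor `N`, `K` imaginary quadratic with the Heegner hypothesis for `N`,
`p ∣ N` (so `p` splits in `K`), `LocIrr W p`: at every place `w ∋ p` of `K`, `#H¹(K_w, E_K[p]) = p²`. [cite: MilneADT2006, Ch. I, Thm. 2.8 and Lemma 3.3]
[cite: GrossLMS1991, §1 (p. 235)] [cite: FouquetWan2021, Thm. 5.1] -/
theorem natCard_localH1_eq_sq_of_locIrr_of_heegner [W.IsGloballyMinimal] (hK : IsImaginaryQuadratic K)
    (hH : SatisfiesHeegnerHypothesis (W.conductorNorm ℤ) K) (hpN : p ∣ W.conductorNorm ℤ) (hL : LocIrr W p)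
    (w : HeightOneSpectrum (𝓞 K)) (hw : ((p : ℕ) : 𝓞 K) ∈ w.asIdeal) :
    Nat.card (galoisCohomology (((W.baseChange K).torsionGaloisModule ((p ^ 1 : ℕ) : ℤ)).toLocal (Sum.inr w : Place K)) 1) =
      p ^ 2 :=
  natCard_localH1_eq_sq_of_locIrr W p hK.1 (hH p (Fact.out : p.Prime) hpN) hL w hw

/-- **`#E_K(K_w)[p] = 1` on the `LocIrr` locus at a split `p`** — the kernel-of-multiplication-by-`p` factor of the Euler-characteristic
products `#H¹(K_w, E[p]) = (#E_K(K_w)[p] · #(𝓞_w ⧸ p))²` (`…OnePlaceLagrangian`, `…LevelJumpAboveP`, `…TwoPlaceLagrangian`).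
[cite: Mazur1977, Ch. III §5, p. 157] [cite: SilvermanAEC2009, VII.3 Prop. 3.1] -/
theorem natCard_ker_nsmul_adicCompletion_eq_one_of_locIrr (hK2 : Module.finrank ℚ K = 2)
    (hsplit : ((Ideal.span {(p : ℤ)}).primesOver (𝓞 K)).ncard = 2) (hL : LocIrr W p)
    (w : HeightOneSpectrum (𝓞 K)) (hw : ((p : ℕ) : 𝓞 K) ∈ w.asIdeal) :
    Nat.card (nsmulAddMonoidHom (p ^ 1) :
        ((W.baseChange K).baseChange (w.adicCompletion K)).toAffine.Point →+ _).ker = 1 := by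
  rw [AddSubgroup.card_eq_one, AddSubgroup.eq_bot_iff_forall]
  intro P hP
  rw [AddMonoidHom.mem_ker, nsmulAddMonoidHom_apply] at hP
  exact forall_nsmul_eq_zero_adicCompletion_of_split W p hK2 hsplit w hw (p ^ 1)
    (forall_nsmul_eq_zero_padic_of_locIrr W p hL) P hP

end LocIrr

/-! ## §5 The split data of the frame: two places above `p`, and no other -/

section Places

variable {K : Type} [Field K] [NumberField K] (p : ℕ) [Fact p.Prime]

/-- **In a quadratic field, two distinct places above `p` are ALL the places above `p`** (`∑ e f = 2`; the `honly` binder of the switched-spaces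
assembly; tree `LocalField.ramificationIdx_eq_one_and_inertiaDeg_eq_one_of_ne`). [cite: CasselsFrohlichANT1967, Ch. II §10 Theorem (10.2)] -/
theorem eq_or_eq_of_ne (hK2 : Module.finrank ℚ K = 2) (𝔭 𝔭' : HeightOneSpectrum (𝓞 K)) (hne : 𝔭 ≠ 𝔭')
    (h𝔭 : ((p : ℕ) : 𝓞 K) ∈ 𝔭.asIdeal) (h𝔭' : ((p : ℕ) : 𝓞 K) ∈ 𝔭'.asIdeal)
    (v : HeightOneSpectrum (𝓞 K)) (hv : ((p : ℕ) : 𝓞 K) ∈ v.asIdeal) : v = 𝔭 ∨ v = 𝔭' := by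
  haveI : Algebra.IsQuadraticExtension ℚ K := ⟨hK2⟩
  exact (LocalField.ramificationIdx_eq_one_and_inertiaDeg_eq_one_of_ne p 𝔭 𝔭' hne h𝔭 h𝔭').2 v hv

/-- **Two primes above a split `p`, as places.** `[K : ℚ] = 2` and two primes of `𝓞 K` above `p` ⟹ there are places `𝔭 ≠ 𝔭'` of `K` containing `p`,
and every place containing `p` is one of them. [cite: CasselsFrohlichANT1967, Ch. II §10 Theorem (10.2)] -/
theorem exists_places_of_split (hK2 : Module.finrank ℚ K = 2)
    (hsplit : ((Ideal.span {(p : ℤ)}).primesOver (𝓞 K)).ncard = 2) :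
    ∃ 𝔭 𝔭' : HeightOneSpectrum (𝓞 K), 𝔭 ≠ 𝔭' ∧ ((p : ℕ) : 𝓞 K) ∈ 𝔭.asIdeal ∧ ((p : ℕ) : 𝓞 K) ∈ 𝔭'.asIdeal ∧
      ∀ v : HeightOneSpectrum (𝓞 K), ((p : ℕ) : 𝓞 K) ∈ v.asIdeal → v = 𝔭 ∨ v = 𝔭' := by
  obtain ⟨P, P', hne, hPP'⟩ := Set.ncard_eq_two.mp hsplit
  have hP : P ∈ (Ideal.span {(p : ℤ)}).primesOver (𝓞 K) := hPP' ▸ Set.mem_insert P {P'}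
  have hP' : P' ∈ (Ideal.span {(p : ℤ)}).primesOver (𝓞 K) := hPP' ▸ Set.mem_insert_of_mem P (Set.mem_singleton P')
  -- a prime over `(p)` contains `p` and is non-zero
  have hmem : ∀ {Q : Ideal (𝓞 K)}, Q ∈ (Ideal.span {(p : ℤ)}).primesOver (𝓞 K) → ((p : ℕ) : 𝓞 K) ∈ Q ∧ Q ≠ ⊥ := by
    intro Q hQ
    have h : ((p : ℕ) : ℤ) ∈ Q.under ℤ := hQ.2.over ▸ Ideal.mem_span_singleton_self _
    rw [Ideal.under_def, Ideal.mem_comap, map_natCast] at h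
    refine ⟨h, fun hQbot ↦ ?_⟩
    rw [hQbot, Ideal.mem_bot, Nat.cast_eq_zero] at h
    exact (Fact.out : p.Prime).ne_zero h
  obtain ⟨hpP, hPbot⟩ := hmem hP
  obtain ⟨hpP', hP'bot⟩ := hmem hP'
  refine ⟨⟨P, hP.1, hPbot⟩, ⟨P', hP'.1, hP'bot⟩, fun h ↦ hne (congrArg HeightOneSpectrum.asIdeal h), hpP, hpP', ?_⟩
  exact eq_or_eq_of_ne p hK2 _ _ (fun h ↦ hne (congrArg HeightOneSpectrum.asIdeal h)) hpP hpP'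

end Places

/-! ## §6 The switched-spaces assembly (stub T2 of `irred-vertex-anchor`) with its plane and split binders discharged on the `LocIrr` locus -/

section Assembly

variable (W : WeierstrassCurve ℚ) (K : Type) [Field K] [NumberField K] (p : ℕ) (c : K ≃ₐ[ℚ] K)
variable [W.IsElliptic] [W.IsGloballyMinimal] [Fact p.Prime] [Module (ZMod p) (Vp W K p)]
  [∀ v : Place K, CompactSpace (absoluteGaloisGroup (Place.Completion v))]

/-- **THE «FL-ENGINE» T2 ON THE `LocIrr` LOCUS** — akr-p2x-w3 g10's `exists_level_switched_eq_bot_card_odd_iff` with the binders `honly`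
(the places above `p` are `𝔭`, `𝔭'`), `hH₁`, `hH₂` (both planes) DISCHARGED: at a frame `p ≥ 5`, `p ∣ N_E`, `ρ̄` onto, `K` imaginary quadratic with
the Heegner hypothesis, `c ≠ 1`, `c² = 1`, two places `𝔭 ≠ 𝔭'` above `p`, and `LocIrr W p` (`E[p]` irreducible as a `G_{ℚ_p}`-module — automatic on
the B-cells of card `irred-vertex-anchor`), for local conditions `L`, `L'` at `𝔭`, `𝔭'` isotropic for every Weil datum, `≠ 0`, `≠` E's Kummer
conditions, with `c`-stable switched condition, and `#Sel_p(E/K) = p^s`: some finite set `n₀` of BD-admissible primes has both switched canonical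
spaces zero and `Odd #n₀ ↔ Odd s`. [cite: WZhang2014, Prop. 5.4, Lemma 7.3, §9] [cite: MilneADT2006, Ch. I, Thm. 2.8, Thm. 4.10]
[cite: Mazur1977, Ch. III §5, p. 157] [cite: CasselsFrohlichANT1967, Ch. II §10 Theorem (10.2)] -/
theorem exists_level_switched_eq_bot_card_odd_iff_of_locIrr (h5 : 5 ≤ p) (hpN : p ∣ W.conductorNorm ℤ)
    (hsurj : W.HasSurjectiveModNGaloisRep p) (hK : IsImaginaryQuadratic K) (hH : SatisfiesHeegnerHypothesis (W.conductorNorm ℤ) K)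
    (hc1 : c ≠ 1) (hcc : c * c = 1) (hL : LocIrr W p)
    (𝔭 𝔭' : HeightOneSpectrum (𝓞 K)) (hne : 𝔭 ≠ 𝔭')
    (h𝔭 : (p : 𝓞 K) ∈ 𝔭.asIdeal) (h𝔭' : (p : 𝓞 K) ∈ 𝔭'.asIdeal)
    (L : AddSubgroup (galoisCohomology (((W.baseChange K).torsionGaloisModule ((p ^ 1 : ℕ) : ℤ)).toLocal (Sum.inr 𝔭 : Place K)) 1))
    (L' : AddSubgroup (galoisCohomology (((W.baseChange K).torsionGaloisModule ((p ^ 1 : ℕ) : ℤ)).toLocal (Sum.inr 𝔭' : Place K)) 1))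
    (hLiso : ∀ (e : geomTorsion (W.baseChange K) ((p ^ 1 : ℕ) : ℤ) → geomTorsion (W.baseChange K) ((p ^ 1 : ℕ) : ℤ) →
        AlgebraicClosure K)
      (hμ : ∀ S T, e S T ^ (p ^ 1) = 1)
      (hadd₁ : ∀ S₁ S₂ T, e (S₁ + S₂) T = e S₁ T * e S₂ T)
      (hadd₂ : ∀ S T₁ T₂, e S (T₁ + T₂) = e S T₁ * e S T₂)
      (hgal : ∀ (σ : absoluteGaloisGroup K) (S T : geomTorsion (W.baseChange K) ((p ^ 1 : ℕ) : ℤ)),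
        σ • e S T = e (σ • S) (σ • T)),
      ∀ a ∈ L, ∀ b ∈ L, (weilContPairingLocal (W.baseChange K) (p ^ 1) e hμ hadd₁ hadd₂ hgal (Sum.inr 𝔭)).cupProduct a b = 0)
    (hL'iso : ∀ (e : geomTorsion (W.baseChange K) ((p ^ 1 : ℕ) : ℤ) → geomTorsion (W.baseChange K) ((p ^ 1 : ℕ) : ℤ) →
        AlgebraicClosure K)
      (hμ : ∀ S T, e S T ^ (p ^ 1) = 1)
      (hadd₁ : ∀ S₁ S₂ T, e (S₁ + S₂) T = e S₁ T * e S₂ T)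
      (hadd₂ : ∀ S T₁ T₂, e S (T₁ + T₂) = e S T₁ * e S T₂)
      (hgal : ∀ (σ : absoluteGaloisGroup K) (S T : geomTorsion (W.baseChange K) ((p ^ 1 : ℕ) : ℤ)),
        σ • e S T = e (σ • S) (σ • T)),
      ∀ a ∈ L', ∀ b ∈ L', (weilContPairingLocal (W.baseChange K) (p ^ 1) e hμ hadd₁ hadd₂ hgal (Sum.inr 𝔭')).cupProduct a b = 0)
    (hL0 : L ≠ ⊥) (hL'0 : L' ≠ ⊥)
    (hLK : L ≠ (W.baseChange K).kummerSelmerStructure ((p ^ 1 : ℕ) : ℤ) (Sum.inr 𝔭))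
    (hL'K : L' ≠ (W.baseChange K).kummerSelmerStructure ((p ^ 1 : ℕ) : ℤ) (Sum.inr 𝔭'))
    (hΛc : ∀ x ∈ (⨅ (v : HeightOneSpectrum (𝓞 K)) (_ : ∃ t ∈ ({p} : Set ℕ), (t : 𝓞 K) ∈ v.asIdeal),
        ((Function.update (Function.update ((W.baseChange K).kummerSelmerStructure ((p ^ 1 : ℕ) : ℤ))
            (Sum.inr 𝔭 : Place K) L : SelmerStructure ((W.baseChange K).torsionGaloisModule ((p ^ 1 : ℕ) : ℤ)))
            (Sum.inr 𝔭' : Place K) L') (Sum.inr v)).comap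
          (galoisCohomology.localization ((W.baseChange K).torsionGaloisModule ((p ^ 1 : ℕ) : ℤ)) (Sum.inr v) 1)),
      conjAct W c ((p ^ 1 : ℕ) : ℤ) x ∈
        (⨅ (v : HeightOneSpectrum (𝓞 K)) (_ : ∃ t ∈ ({p} : Set ℕ), (t : 𝓞 K) ∈ v.asIdeal),
        ((Function.update (Function.update ((W.baseChange K).kummerSelmerStructure ((p ^ 1 : ℕ) : ℤ))
            (Sum.inr 𝔭 : Place K) L : SelmerStructure ((W.baseChange K).torsionGaloisModule ((p ^ 1 : ℕ) : ℤ)))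
            (Sum.inr 𝔭' : Place K) L') (Sum.inr v)).comap
          (galoisCohomology.localization ((W.baseChange K).torsionGaloisModule ((p ^ 1 : ℕ) : ℤ)) (Sum.inr v) 1)))
    (s : ℕ) (hs : Nat.card (selmerGroup (W.baseChange K) ((p ^ 1 : ℕ) : ℤ)) = p ^ s) :
    ∃ n₀ : Finset (AdmQ W K p),
      (∀ μ, AddSubgroup.toZModSubmodule p (levelSelmerSubgroupP W K p c (n₀.image Subtype.val) {p} μ ⊓
        (⨅ (v : HeightOneSpectrum (𝓞 K)) (_ : ∃ t ∈ ({p} : Set ℕ), (t : 𝓞 K) ∈ v.asIdeal),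
          ((Function.update (Function.update ((W.baseChange K).kummerSelmerStructure ((p ^ 1 : ℕ) : ℤ))
              (Sum.inr 𝔭 : Place K) L : SelmerStructure ((W.baseChange K).torsionGaloisModule ((p ^ 1 : ℕ) : ℤ)))
              (Sum.inr 𝔭' : Place K) L') (Sum.inr v)).comap
            (galoisCohomology.localization ((W.baseChange K).torsionGaloisModule ((p ^ 1 : ℕ) : ℤ)) (Sum.inr v) 1))) = ⊥) ∧
      (Odd n₀.card ↔ Odd s) :=
  exists_level_switched_eq_bot_card_odd_iff W K p c h5 hpN hsurj hK hH hc1 hcc 𝔭 𝔭' hne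
    (eq_or_eq_of_ne p hK.1 𝔭 𝔭' hne h𝔭 h𝔭')
    h𝔭 h𝔭'
    (natCard_localH1_eq_sq_of_locIrr_of_heegner W p hK hH hpN hL 𝔭 h𝔭)
    (natCard_localH1_eq_sq_of_locIrr_of_heegner W p hK hH hpN hL 𝔭' h𝔭')
    L L' hLiso hL'iso hL0 hL'0 hLK hL'K hΛc s hs

end Assembly

/-! ## §7 (T4) `BdpSwitchAtBottom` unconditional on the `LocIrr` locus -/

section Bottom

variable (W : WeierstrassCurve ℚ) [W.IsElliptic] [W.IsGloballyMinimal] {K : Type} [Field K] [NumberField K] (p : ℕ) [Fact p.Prime]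

/-- **(T4) of card `theta-cycle-seed` at a ♯ frame, DUAL.2 and both planes discharged.** `W/ℚ`, `K` imaginary quadratic with the Heegner hypothesis
for `N_E`, `p ∣ N_E` odd, `LocIrr W p`, `𝔭 ≠ 𝔭'` above `p`: if `#H¹_𝓚(K, E_K[p]) = p` with `loc_𝔭`, `loc_{𝔭'}` injective on it, then the Selmer group of
`𝓚[𝔭 ↦ ⊤][𝔭' ↦ ⊥]` is trivial — `ThetaCycleSeed.bdpSwitchAtBottom` at the PROVED Poitou–Tate fact (`poitouTate_selmerStructure_duality_holds`) and the
planes of §4. [cite: JetchevSkinnerWan2017, (3.5.d)] [cite: MilneADT2006, Ch. I, Thm. 4.10, Lemma 6.15] -/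
theorem bdpSwitchAtBottom_of_locIrr (hK : IsImaginaryQuadratic K) (hH : SatisfiesHeegnerHypothesis (W.conductorNorm ℤ) K)
    (hpN : p ∣ W.conductorNorm ℤ) (hp2 : p ≠ 2) (hL : LocIrr W p) (𝔭 𝔭' : HeightOneSpectrum (𝓞 K)) (hne : 𝔭 ≠ 𝔭')
    (h𝔭 : ((p : ℕ) : 𝓞 K) ∈ 𝔭.asIdeal) (h𝔭' : ((p : ℕ) : 𝓞 K) ∈ 𝔭'.asIdeal)
    (hSel : Nat.card ((W.baseChange K).kummerSelmerStructure ((p ^ 1 : ℕ) : ℤ)).selmerGroup = p)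
    (hinj : ∀ x ∈ ((W.baseChange K).kummerSelmerStructure ((p ^ 1 : ℕ) : ℤ)).selmerGroup,
      galoisCohomology.localization ((W.baseChange K).torsionGaloisModule ((p ^ 1 : ℕ) : ℤ)) (Sum.inr 𝔭 : Place K) 1 x = 0 → x = 0)
    (hinj' : ∀ x ∈ ((W.baseChange K).kummerSelmerStructure ((p ^ 1 : ℕ) : ℤ)).selmerGroup,
      galoisCohomology.localization ((W.baseChange K).torsionGaloisModule ((p ^ 1 : ℕ) : ℤ)) (Sum.inr 𝔭' : Place K) 1 x = 0 → x = 0) :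
    Nat.card (SelmerStructure.selmerGroup
      (Function.update (Function.update ((W.baseChange K).kummerSelmerStructure ((p ^ 1 : ℕ) : ℤ)) (Sum.inr 𝔭 : Place K) ⊤)
        (Sum.inr 𝔭' : Place K) ⊥ : SelmerStructure ((W.baseChange K).torsionGaloisModule ((p ^ 1 : ℕ) : ℤ)))) = 1 :=
  ThetaCycleSeed.bdpSwitchAtBottom K (W.baseChange K) p 𝔭 𝔭' hp2 (poitouTate_selmerStructure_duality_holds K) hne
    (natCard_localH1_eq_sq_of_locIrr_of_heegner W p hK hH hpN hL 𝔭 h𝔭)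
    (natCard_localH1_eq_sq_of_locIrr_of_heegner W p hK hH hpN hL 𝔭' h𝔭') hSel hinj hinj'

end Bottom

end Summit.BirchSwinnertonDyer.BirchSwinnertonDyer.Theorems.AdditiveKoly.SplitPlane

end
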